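import Summits.ValiantsHypothesis.ValiantsHypothesis.Theorems.BarrierLeverChowBenchmarkPairsKernelPeelRows

/-!
# Route BarrierLever — item 22038 `ChowBenchmarkPairs`, line `moore-peel`: the BLOCK PEEL (`t` tied points
# peeled at one scale), I — block labels, the block matrix `J^κ(i,t)(Λ)`, and the row entries after the tied
# substitution `Y_{n+s} ↦ Λ_s · X`

Helper file (`--supports stmt-ValiantsHypothesis-22038`; cell valiant-natproofs, rung V4, 𝒟-side benchmark of
record, line `moore_peel`, planner kernel target **K1** (HOME/STATUS.md l.1746); seat val-np-p4 gen 29).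
Closes NO item.  Definitions `BlockIdx`, `blockWidth`, `pairCoef`, `blockEntry`, `blockMatrix` and their API;
the theorems of the block peel live in the companion files `…BlockPeelStage`, `…BlockPeelLead`, `…BlockPeel`.

WHY.  THEOREM A^κ (`…KernelPeel`, one point peeled per stage, stage matrices `G^κ_i = kpeelMatrix κ i`) dies
for the segment kernel at `i = 183` (`det G_183 = 0`, THEOREM W).  The seat memo
`HOME/val-np-p4/g28/memo/MEMO-valnp4-g28.md` §1 («block peel theorem») expands the next `t` points TOGETHER
at one scale `ε` with generic ratios `Λ_s`: the `ε`-leading term is governed by ONE square matrix `J(i,t)(Λ)`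
on the multi-window of codes `[c_i, c_{i+t})`, of size `t·i + t(t-1)/2`, whose rows are the `t·i` attached
rows `(T_j, {n+s})` and the `t(t-1)/2` internal pair rows `(∅, {n+s'', n+s})` of the block:

* row `(T_j, s)`, column `B`:      `[T_j ⊆ B] · κ(|B| - |T_j|) · Λ_s^{B - j}`;
* row `(s'', s)` (`s'' < s`), column `B`:  `Σ_{d ⊆ B} κ|B∖d| · κ|d| · Λ_{s''}^{bin(B∖d)} · Λ_s^{bin d}`.

`det J ≢ 0` (as a polynomial in `Λ`) replaces `det G^κ_i ≠ 0` for the `t` stages `i, …, i+t-1` at once; the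
certificates of record (kit j323569/j323570/j324541/j324542: every bad stage of THEOREM W below `20 070` lies
in a nonsingular tied block) are instances of this hypothesis.  In the Lean indexing of `…KernelPeel` (stage
`i` carries the attached rows `T_j`, `j < i`), `blockMatrix κ i t` is the memo's `J(i-1, t)`.

* `BlockIdx i t = Σ s : Fin t, Fin (i + s)` — point `s` of the block carries `i + s` block rows: `q < i` is
  the attached row `(T_q, {n+s})`, `q = i + s''` (`s'' < s`) the internal pair row `(n+s'', n+s)`;
  `blockWidth i t = Σ_{s<t} (i+s) = c_{i+t} - c_i` (`windowStart_add_blockWidth`); the position of a block row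
  in the multi-window is `finSigmaFinEquiv` (point `s`'s rows occupy the sub-window `[c_{i+s}, c_{i+s+1})`).
* `pairCoef κ y y' B`, `blockEntry κ i Λ ρ B`, `blockMatrix κ i t Λ` (square, over any commutative ring;
  `map_pairCoef`, `map_blockEntry`, `blockMatrix_map`).
* Entries after the tied substitution `Z b = C (Y b) · X` (`b` in the block), `Z c = C (Y c)` (`c` fixed):
  `X_pow_mul_krow_single_tied`, `krow_single_tied_sub_fixed` (attached block rows),
  `krow_pair_tied_tied`, `krow_pair_tied_tied_sub_fixed` (internal pair rows),
  `krow_pair_fixed_tied`, `krow_pair_fixed_tied_sub_fixed` (external pair rows `(c, n+s)`).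

WHAT THIS IS NOT: no stub of line `moore_peel` is closed; `stub_segmentMeanValue` (∀ h) is untouched; nothing
on crux stmt-ValiantsHypothesis-14610 or on `VP` versus `VNP`.
-/

set_option linter.dupNamespace false

namespace Summit.ValiantsHypothesis.ValiantsHypothesis.Theorems.BarrierLever.MoorePeel

open Polynomial Finset

/-! ## 1. Block labels and the multi-window -/

/-- **Block row labels.**  Point `s < t` of a tied block peeled at stage `i` carries `i + s` block rows:
`q < i` is the attached row `(T_q, {n+s})`, `q = i + s''` with `s'' < s` the internal pair row
`(∅, {n+s'', n+s})`. -/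
abbrev BlockIdx (i t : ℕ) : Type := Σ s : Fin t, Fin (i + (s : ℕ))

/-- The width `Σ_{s<t} (i+s) = t·i + t(t-1)/2` of the multi-window `[c_i, c_{i+t})`. -/
def blockWidth (i t : ℕ) : ℕ := ∑ s : Fin t, (i + (s : ℕ))

/-- `c_{i+t} = c_i + blockWidth i t`. -/
theorem windowStart_add_blockWidth (i t : ℕ) : windowStart (i + t) = windowStart i + blockWidth i t := by
  induction t with
  | zero => simp [blockWidth]
  | succ t ih =>
    rw [← add_assoc, windowStart_succ, ih, blockWidth, blockWidth, Fin.sum_univ_castSucc]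
    simp only [Fin.val_castSucc, Fin.val_last]
    ring

/-- The position of a block row inside the multi-window is `< blockWidth i t`. -/
theorem finSigmaFinEquiv_lt_blockWidth {i t : ℕ} (ρ : BlockIdx i t) :
    (finSigmaFinEquiv ρ : ℕ) < blockWidth i t := (finSigmaFinEquiv ρ).2

/-! ## 2. The block matrix -/

/-- **The internal pair coefficient** `Σ_{d ⊆ T_B} κ|T_B∖d| · y^{bin(T_B∖d)} · κ|d| · y'^{bin d}`: the pair row
`(∅, {b, b'})` at column `B` when BOTH points are tied, `Y_b = y·X`, `Y_{b'} = y'·X`, divided by `X^B`. -/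
def pairCoef {R : Type*} [CommRing R] (κ : ℕ → ℕ) (y y' : R) (B : ℕ) : R :=
  ∑ d ∈ (bits B).powerset, ((κ (bits B \ d).card : ℕ) : R) * y ^ bin (bits B \ d) *
    (((κ d.card : ℕ) : R) * y' ^ bin d)

/-- **The entries of the (unbounded) block matrix** at column code `B`, for ratios `Λ : Fin t → R`:
row `⟨s, q⟩` with `q < i` ↦ `[T_q ⊆ B]·κ(|B|-|T_q|)·Λ_s^{B-q}`; with `q = i + s''` ↦ `pairCoef κ Λ_{s''} Λ_s B`. -/
def blockEntry {R : Type*} [CommRing R] (κ : ℕ → ℕ) (i : ℕ) {t : ℕ} (Λ : Fin t → R)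
    (ρ : BlockIdx i t) (B : ℕ) : R :=
  if (ρ.2 : ℕ) < i then ((kincl κ (ρ.2 : ℕ) B : ℕ) : R) * Λ ρ.1 ^ (B - (ρ.2 : ℕ))
  else pairCoef κ (Λ ⟨(ρ.2 : ℕ) - i, by have := ρ.2.2; have := ρ.1.2; omega⟩) (Λ ρ.1) B

/-- **The block matrix `J^κ(i,t)(Λ)`**: block rows × the multi-window `[c_i, c_{i+t})` (column `ρ'` is the code
`c_i + finSigmaFinEquiv ρ'`). For `t = 1` this is `G^κ_i` up to the monomial column/row scaling by `Λ_0`. -/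
def blockMatrix {R : Type*} [CommRing R] (κ : ℕ → ℕ) (i t : ℕ) (Λ : Fin t → R) :
    Matrix (BlockIdx i t) (BlockIdx i t) R :=
  Matrix.of fun ρ ρ' => blockEntry κ i Λ ρ (windowStart i + (finSigmaFinEquiv ρ' : ℕ))

section Map

variable {R S : Type*} [CommRing R] [CommRing S] (f : R →+* S) (κ : ℕ → ℕ)

/-- Ring homomorphisms act on `pairCoef` through the two ratios. -/
theorem map_pairCoef (y y' : R) (B : ℕ) : f (pairCoef κ y y' B) = pairCoef κ (f y) (f y') B := by
  unfold pairCoef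
  rw [map_sum]
  refine Finset.sum_congr rfl fun d _ => ?_
  simp only [map_mul, map_natCast, map_pow]

/-- Ring homomorphisms act on `blockEntry` through the ratios. -/
theorem map_blockEntry (i : ℕ) {t : ℕ} (Λ : Fin t → R) (ρ : BlockIdx i t) (B : ℕ) :
    f (blockEntry κ i Λ ρ B) = blockEntry κ i (fun s => f (Λ s)) ρ B := by
  unfold blockEntry
  split_ifs
  · simp only [map_mul, map_natCast, map_pow]
  · rw [map_pairCoef]

/-- Ring homomorphisms act on the block matrix through the ratios. -/
theorem blockMatrix_map (i t : ℕ) (Λ : Fin t → R) :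
    (blockMatrix κ i t Λ).map f = blockMatrix κ i t (fun s => f (Λ s)) := by
  ext ρ ρ'
  rw [Matrix.map_apply, blockMatrix, blockMatrix, Matrix.of_apply, Matrix.of_apply, map_blockEntry]

/-- The determinant of the block matrix is natural in the ratios. -/
theorem map_det_blockMatrix (i t : ℕ) (Λ : Fin t → R) :
    f (blockMatrix κ i t Λ).det = (blockMatrix κ i t (fun s => f (Λ s))).det := by
  rw [RingHom.map_det, RingHom.mapMatrix_apply, blockMatrix_map]

end Map

/-! ## 3. Entries after the tied substitution `Y_b ↦ y · X` -/

section Entries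

variable {R : Type*} [CommRing R] (κ : ℕ → ℕ) (r : ℕ)

/-- For `d ⊆ T`: `bin (T ∖ d) + bin d = bin T`. -/
theorem bin_sdiff_add_bin {d T : Finset ℕ} (hd : d ⊆ T) : bin (T \ d) + bin d = bin T :=
  Finset.sum_sdiff hd

/-- **Attached rows of a tied point.**  If `Z b = C y · X` then
`X^j · krow (T_j, {b}) col = C (G̃^κ[j, col] · y^{col - j}) · X^col`. -/
theorem X_pow_mul_krow_single_tied (Z : ℕ → R[X]) (b : ℕ) (y : R) (hZ : Z b = C y * X) (j : ℕ)
    (col : Fin r) :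
    X ^ j * krow κ r Z (Sum.inr (Sum.inl (j, b))) col =
      C (((kincl κ j (col : ℕ) : ℕ) : R) * y ^ ((col : ℕ) - j)) * X ^ (col : ℕ) := by
  simp only [krow, hZ, kincl]
  split_ifs with hsub
  · have e := add_bin_sdiff_eq hsub
    have e2 : (col : ℕ) - j = bin (bits (col : ℕ) \ bits j) := by omega
    rw [mul_pow, ← mul_assoc, map_mul, map_natCast, map_pow, e2]
    have e4 : (X : R[X]) ^ (col : ℕ) = X ^ j * X ^ bin (bits (col : ℕ) \ bits j) := by
      rw [← pow_add, e]
    rw [e4]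
    ring
  · simp

/-- **Attached rows of a tied point, reduced against the fixed monomial rows** `e_m`, `m < c_i`:
what is left is `col ↦ [c_i ≤ col] · C (G̃^κ[j, col] · y^{col-j}) · X^col`. -/
theorem krow_single_tied_sub_fixed (Z : ℕ → R[X]) (b : ℕ) (y : R) (hZ : Z b = C y * X) (i j : ℕ)
    (col : Fin r) :
    X ^ j * krow κ r Z (Sum.inr (Sum.inl (j, b))) col -
      ∑ m ∈ Finset.range (windowStart i), (C (((kincl κ j m : ℕ) : R) * y ^ (m - j)) * X ^ m) *
        (if (col : ℕ) = m then (1 : R[X]) else 0) =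
      if (col : ℕ) < windowStart i then 0
      else C (((kincl κ j (col : ℕ) : ℕ) : R) * y ^ ((col : ℕ) - j)) * X ^ (col : ℕ) := by
  rw [X_pow_mul_krow_single_tied κ r Z b y hZ j col]
  simp_rw [mul_ite, mul_one, mul_zero]
  rw [Finset.sum_ite_eq (Finset.range (windowStart i)) (col : ℕ)]
  simp only [Finset.mem_range]
  split_ifs with hlt
  · exact sub_self _
  · exact sub_zero _

/-- **Internal pair rows of the block.**  If `Z b = C y · X` and `Z b' = C y' · X` then
`krow (∅, {b, b'}) col = C (pairCoef κ y y' col) · X^col`. -/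
theorem krow_pair_tied_tied (Z : ℕ → R[X]) (b b' : ℕ) (y y' : R) (hZb : Z b = C y * X)
    (hZb' : Z b' = C y' * X) (col : Fin r) :
    krow κ r Z (Sum.inr (Sum.inr (b, b'))) col = C (pairCoef κ y y' (col : ℕ)) * X ^ (col : ℕ) := by
  simp only [krow, hZb, hZb', pairCoef]
  rw [map_sum, Finset.sum_mul]
  refine Finset.sum_congr rfl fun d hd => ?_
  have hdT : d ⊆ bits (col : ℕ) := Finset.mem_powerset.mp hd
  have e : bin (bits (col : ℕ) \ d) + bin d = (col : ℕ) := by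
    rw [bin_sdiff_add_bin hdT, bin_bits]
  rw [map_mul, map_mul, map_mul, map_natCast, map_natCast, map_pow, map_pow, mul_pow, mul_pow]
  have e3 : ((κ (bits (col : ℕ) \ d).card : ℕ) : R[X]) * (C y ^ bin (bits (col : ℕ) \ d) *
      X ^ bin (bits (col : ℕ) \ d)) * (((κ d.card : ℕ) : R[X]) * (C y' ^ bin d * X ^ bin d)) =
      ((κ (bits (col : ℕ) \ d).card : ℕ) : R[X]) * C y ^ bin (bits (col : ℕ) \ d) *
        (((κ d.card : ℕ) : R[X]) * C y' ^ bin d) * (X ^ bin (bits (col : ℕ) \ d) * X ^ bin d) := by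
    ring
  rw [e3, ← pow_add, e]

/-- **Internal pair rows, reduced against the fixed monomial rows**: `col ↦ [c_i ≤ col]·C(pairCoef)·X^col`. -/
theorem krow_pair_tied_tied_sub_fixed (Z : ℕ → R[X]) (b b' : ℕ) (y y' : R) (hZb : Z b = C y * X)
    (hZb' : Z b' = C y' * X) (i : ℕ) (col : Fin r) :
    krow κ r Z (Sum.inr (Sum.inr (b, b'))) col -
      ∑ m ∈ Finset.range (windowStart i), (C (pairCoef κ y y' m) * X ^ m) *
        (if (col : ℕ) = m then (1 : R[X]) else 0) =
      if (col : ℕ) < windowStart i then 0 else C (pairCoef κ y y' (col : ℕ)) * X ^ (col : ℕ) := by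
  rw [krow_pair_tied_tied κ r Z b b' y y' hZb hZb' col]
  simp_rw [mul_ite, mul_one, mul_zero]
  rw [Finset.sum_ite_eq (Finset.range (windowStart i)) (col : ℕ)]
  simp only [Finset.mem_range]
  split_ifs with hlt
  · exact sub_self _
  · exact sub_zero _

/-- **External pair rows** (a fixed point `c` and a tied point `b`).  If `Z c = C yc` and `Z b = C y · X`
then `krow (∅, {c, b}) col = Σ_{d ⊆ T_col} C(κ|T∖d| · yc^{bin(T∖d)} · κ|d| · y^{bin d}) · X^{bin d}`. -/
theorem krow_pair_fixed_tied (Z : ℕ → R[X]) (c b : ℕ) (yc y : R) (hZc : Z c = C yc)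
    (hZb : Z b = C y * X) (col : Fin r) :
    krow κ r Z (Sum.inr (Sum.inr (c, b))) col = ∑ d ∈ (bits (col : ℕ)).powerset,
      C ((((κ (bits (col : ℕ) \ d).card : ℕ) : R)) * yc ^ bin (bits (col : ℕ) \ d) *
        (((κ d.card : ℕ) : R) * y ^ bin d)) * X ^ bin d := by
  simp only [krow, hZc, hZb]
  refine Finset.sum_congr rfl fun d _ => ?_
  rw [map_mul, map_mul, map_mul, map_pow, map_natCast, map_natCast, map_pow, mul_pow]
  ring

/-- **External pair rows, reduced against the fixed attached rows.**  With `Z c = C (Y c)`,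
`Z b = C (Y b) · X`: subtracting `κ|T_{j'}| · (Y b)^{j'} · X^{j'} · (T_{j'}, {c})` for `j' < i` from the pair
row `(∅, {c, b})` leaves exactly the terms with `bin d ≥ i`. -/
theorem krow_pair_fixed_tied_sub_fixed (Y : ℕ → R) (Z : ℕ → R[X]) (c b i : ℕ) (hZc : Z c = C (Y c))
    (hZb : Z b = C (Y b) * X) (col : Fin r) :
    krow κ r Z (Sum.inr (Sum.inr (c, b))) col -
      ∑ j' ∈ Finset.range i, (C ((((κ (bits j').card : ℕ) : R)) * Y b ^ j') * X ^ j') *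
        C (krow κ r Y (Sum.inr (Sum.inl (j', c))) col) =
    ∑ d ∈ (bits (col : ℕ)).powerset.filter (fun d => i ≤ bin d),
      C ((((κ (bits (col : ℕ) \ d).card : ℕ) : R)) * Y c ^ bin (bits (col : ℕ) \ d) *
        (((κ d.card : ℕ) : R) * Y b ^ bin d)) * X ^ bin d := by
  rw [krow_pair_fixed_tied κ r Z c b (Y c) (Y b) hZc hZb col, sub_eq_iff_eq_add,
    ← Finset.sum_filter_add_sum_filter_not (bits (col : ℕ)).powerset (fun d => i ≤ bin d)]
  congr 1
  -- the terms with `bin d < i` are the subtracted attached rows, reindexed by `d = bits j'`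
  set T := bits (col : ℕ) with hT
  have hsub0 : ∀ j' ∈ Finset.range i, ¬ bits j' ⊆ T →
      (C ((((κ (bits j').card : ℕ) : R)) * Y b ^ j') * X ^ j') *
        C (krow κ r Y (Sum.inr (Sum.inl (j', c))) col) = 0 := by
    intro j' _ hj'
    simp only [krow, ← hT, if_neg hj', map_zero, mul_zero]
  rw [← Finset.sum_filter_of_ne (s := Finset.range i) (p := fun j' => bits j' ⊆ T)
    (fun j' hj' hne => by_contra fun hns => hne (hsub0 j' hj' hns))]
  have himage : (T.powerset.filter fun d => ¬ i ≤ bin d) =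
      ((Finset.range i).filter fun j' => bits j' ⊆ T).image bits := by
    ext d
    simp only [Finset.mem_filter, Finset.mem_powerset, Finset.mem_image, Finset.mem_range, not_le]
    constructor
    · rintro ⟨hdT, hdi⟩
      exact ⟨bin d, ⟨hdi, by rwa [bits_bin]⟩, bits_bin d⟩
    · rintro ⟨j', ⟨hj'i, hj'T⟩, rfl⟩
      exact ⟨hj'T, by rwa [bin_bits]⟩
  rw [himage, Finset.sum_image fun a _ b _ e => bits_injective e]
  refine Finset.sum_congr rfl fun j' hj' => ?_
  have hj'T : bits j' ⊆ T := (Finset.mem_filter.mp hj').2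
  simp only [krow, ← hT, if_pos hj'T, bin_bits, Finset.card_sdiff_of_subset hj'T, map_mul, map_pow,
    map_natCast]
  ring

end Entries

end Summit.ValiantsHypothesis.ValiantsHypothesis.Theorems.BarrierLever.MoorePeel
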